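import Summits.Parity.GeneralizedHardyLittlewood.Theorems.LeeYangFibresRelativeDimOneTypeDefs
import HarnessLib

/-!
# Route `LeeYangFibres`, crux `RelativeDimOne` (stmt-Parity-14113): vocabulary of the line `floating-level-core` —
# the FLAT (floating-level) statements

Route-posited objects (D-0016 `<Route><Crux>Defs` file) for the checked skeleton
`Cruxes/RelativeDimOne/Lines/floating_level_core.lean` (lead seat a1). NOTHING IS ASSERTED: every `def … : Prop` below
is a statement — the type (or a component of the type) of a registered stub of that skeleton
(`stub_flatSecondMoment : NoSiegelZeros → LowClassSecondMomentFlat`, `stub_typeClassMomentsFlat :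
LowClassSecondMomentFlat → TypeClassMomentsFlat`, `stub_typeDataFlat : … → TypeDataFlat θ`,
`stub_endgameFlat : ∀ θ, 0 < θ → θ < 1 → EndgameFlat θ`). The bridges to the landed fixed-level vocabulary
(`Theorems/LeeYangFibresRelativeDimOneTypeDefs.lean`, `…SplitDefs.lean`) are PROVED (`Iff.rfl` / quantifier
re-ordering); `lowClassSecondMoment_iff` is the registered sub-goal this file lands under.

THE LEVER. In the landed type split `RelativeDimOne ↔ IncidenceBandlimitedCoreDecay θ ∧ LowClassSecondMoment θ₁`
(`Theorems/LeeYangFibresRelativeDimOneTypeSplit.lean`) the `L`-input is consumed ONCE and at a level-INDEPENDENT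
accuracy, the level `θ₁` entering only thresholds. Moving the level existential AFTER the accuracy turns the
quasi-GRH conjunct `LowClassSecondMoment θ₁` (fixed power level) into the Linnik-range statement
`LowClassSecondMomentFlat := ∀ ε ∃ θ₁ > 0 ∃ N₀ …`; the flat type-class moments, type data and endgame are the
landed bodies verbatim with the same re-ordering.

References: Green–Tao, Ann. of Math. 171 (2010), Conj. 1.4 [GreenTao2010]; Gallagher, Invent. Math. 11 (1970), Thm 7
[Gallagher1970]; Gallagher, Mathematika 23 (1976) §2 [Gallagher1976].
-/

noncomputable section

open scoped BigOperators Classical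
open Finset Literature.NumberTheory.Sieve
open Summit.Parity.GeneralizedHardyLittlewood.Theses.LeeYangFibres (RelativeDimOne)
open Summit.Parity.GeneralizedHardyLittlewood.Cruxes.RelativeDimOne.GallagherBackwards (classPsi)
open Summit.Parity.GeneralizedHardyLittlewood.Cruxes.RelativeDimOne.GallagherBackwardsSplit
open Summit.Parity.GeneralizedHardyLittlewood.Cruxes.RelativeDimOne.TypeSplit

namespace Summit.Parity.GeneralizedHardyLittlewood.Cruxes.RelativeDimOne.FloatingLevelCore

/-! ### The flat class second moment (Linnik's range) -/

/-- The conclusion of the class second moment at level `θ₁`, accuracy `ε`, threshold `N₀`: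
`Σ_{a mod q} ψ(N; q, a)² ≤ (1 + ε)(N²/φ(q) + N log N)` for all `N ≥ N₀` and `1 ≤ q ≤ N^{θ₁}` — the body of the
landed `LowClassSecondMoment θ₁` after its `∃ N₀` (see `lowClassSecondMoment_iff`). -/
def LowClassSecondMomentAt (θ₁ ε : ℝ) (N₀ : ℕ) : Prop :=
  ∀ N : ℕ, N₀ ≤ N → ∀ q : ℕ, 1 ≤ q → (q : ℝ) ≤ (N : ℝ) ^ θ₁ →
    ∑ a ∈ Finset.range q, classPsi N q a ^ 2 ≤ (1 + ε) * ((N : ℝ) ^ 2 / Nat.totient q + N * Real.log N)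

/-- **L♭ — the class second moment at FLOATING level** (Linnik's range): for every `ε > 0` there are
`θ₁ = θ₁(ε) > 0` and `N₀` with `Σ_{a mod q} ψ(N; q, a)² ≤ (1 + ε)(N²/φ(q) + N log N)` for all `N ≥ N₀`,
`1 ≤ q ≤ N^{θ₁}`. The level is chosen AFTER the accuracy (contrast `LowClassSecondMoment θ₁`: one level for all
`ε`); the shape of Gallagher's 1970 Theorem 7 in Linnik's range. -/
def LowClassSecondMomentFlat : Prop :=
  ∀ ε : ℝ, 0 < ε → ∃ θ₁ : ℝ, 0 < θ₁ ∧ ∃ N₀ : ℕ, LowClassSecondMomentAt θ₁ ε N₀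

/-! ### The flat type-class moving moments -/

/-- The conclusion of the type-class moving moments at level `θ₁`, data `(t, L, δ, ε)`, threshold `N₀` — the body
of the landed `TypeClassMoments θ₁` after its `∃ N₀`, verbatim (see `typeClassMoments_iff`). -/
def TypeClassMomentsAt (θ₁ : ℝ) (t L : ℕ) (δ ε : ℝ) (N₀ : ℕ) : Prop :=
  ∀ N : ℕ, N₀ ≤ N →
    ∀ q : ℕ, 1 ≤ q → Squarefree q → (q : ℝ) ≤ (N : ℝ) ^ θ₁ →
      ∀ a b₀ u : Fin t → ℤ, (∀ i, a i ≠ 0 ∧ |a i| ≤ L) →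
        ∀ X : Fin t → ℕ, (∀ i, δ * N ≤ (X i : ℝ)) →
          ∀ W : ℕ, δ * N ≤ W →
            (∀ i, ∀ n : ℕ, n < W →
              δ * N + 1 ≤ ((a i * n + u i : ℤ) : ℝ) ∧ ((a i * n + u i + X i : ℤ) : ℝ) ≤ L * N) →
            |(∑ n ∈ Finset.range W, ∑ c ∈ typeCell q q a b₀,
                ∏ i, (classPsi (a i * n + u i + X i).toNat q (resid q (a i * n + c i))
                      - classPsi (a i * n + u i - 1).toNat q (resid q (a i * n + c i))))
              - (∏ i, ((X i : ℝ) + 1)) / (Nat.totient q : ℝ) ^ t * (coprimePairs q a b₀ W : ℝ)|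
              ≤ ε * (∏ i, ((X i : ℝ) + 1)) *
                  ((coprimePairs q a b₀ W : ℝ) / (Nat.totient q : ℝ) ^ t
                    + W * ((typeCell q q a b₀).card : ℝ) / (q : ℝ) ^ t)

/-- **TCM♭ — type-class moving moments at FLOATING level**: `∀ t L δ ε ∃ θ₁ > 0 ∃ N₀ …` (same body as the
landed `TypeClassMoments θ₁`, whose prefix is `∀ t L δ ε ∃ N₀` at one level `θ₁` for all data). -/
def TypeClassMomentsFlat : Prop :=
  ∀ (t L : ℕ), 1 ≤ t → ∀ δ ε : ℝ, 0 < δ → 0 < ε → ∃ θ₁ : ℝ, 0 < θ₁ ∧ ∃ N₀ : ℕ,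
    TypeClassMomentsAt θ₁ t L δ ε N₀

/-! ### The flat type data and the flat endgame -/

/-- The conclusion of the type data at level `θ` for `(t, L, L₁, D, C, η, ε, N₀)` — the body of the landed
`TypeData θ` after its `∃ N₀`, verbatim (see `typeData_iff`). -/
def TypeDataAt (θ : ℝ) (t L L₁ D : ℕ) (C η ε : ℝ) (N₀ : ℕ) : Prop :=
  ∀ N : ℕ, N₀ ≤ N →
    ∀ f : (Fin t → ℤ) → ℕ → (Fin t → ℤ) → ℝ,
      (∀ a, TypeInvariant a (f a)) → (∀ a, HasDecay C a (f a)) → CoreApprox θ t L₁ N ε f →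
      ∀ a b₀ : Fin t → ℤ, (∀ i, a i ≠ 0 ∧ |a i| ≤ L) → (∀ i, |b₀ i| ≤ L * N) →
        IsNondegenerateSystem (sys a b₀) →
        |condSum (level θ N) (wlev D N) a b₀ (f a) - singularProductPartial (sys a b₀) (wlev D N)|
          ≤ η * gscale (wlev D N) a b₀

/-- **TypeData♭ — the type data with the conditioning depth chosen AFTER the accuracy**:
`∀ t L ∃ L₁ ≥ L ∀ C η ∃ D₀ ∀ D ≥ D₀ ∃ ε > 0 ∃ N₀ …` (same body as the landed `TypeData θ`, whose prefix is
`∀ t L ∃ D₀ L₁ ∀ D ≥ D₀ ∀ C η ∃ ε ∃ N₀`). -/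
def TypeDataFlat (θ : ℝ) : Prop :=
  ∀ (t L : ℕ), 1 ≤ t → ∃ L₁ : ℕ, L ≤ L₁ ∧ ∀ C η : ℝ, 0 < C → 0 < η → ∃ D₀ : ℕ, ∀ D : ℕ, D₀ ≤ D →
    ∃ ε : ℝ, 0 < ε ∧ ∃ N₀ : ℕ, TypeDataAt θ t L L₁ D C η ε N₀

/-- **Endgame♭** — the landed `Endgame θ` with `TypeDataFlat θ` in place of `TypeData θ`: the core at level `θ`,
the flat type data, type rigidity and the singular-weight facts imply the crux. -/
def EndgameFlat (θ : ℝ) : Prop :=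
  IncidenceBandlimitedCoreDecay θ → TypeDataFlat θ → TypeRigidity → SingularWeightFacts → RelativeDimOne

/-! ### The flat statements against the landed fixed-level ones (all PROVED) -/

/-- The landed `L`-atom `LowClassSecondMoment θ₁` unfolds to its `…At` form (by `Iff.rfl`) — the registered
sub-goal under which this vocabulary file lands. -/
theorem lowClassSecondMoment_iff :
    ∀ θ₁ : ℝ, LowClassSecondMoment θ₁ ↔ ∀ ε : ℝ, 0 < ε → ∃ N₀ : ℕ, LowClassSecondMomentAt θ₁ ε N₀ :=
  fun _ => Iff.rfl

/-- The landed type-class moments `TypeClassMoments θ₁` unfold to their `…At` form (by `Iff.rfl`). -/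
theorem typeClassMoments_iff (θ₁ : ℝ) :
    TypeClassMoments θ₁ ↔
      ∀ (t L : ℕ), 1 ≤ t → ∀ δ ε : ℝ, 0 < δ → 0 < ε → ∃ N₀ : ℕ, TypeClassMomentsAt θ₁ t L δ ε N₀ :=
  Iff.rfl

/-- The landed type data `TypeData θ` unfold to their `…At` form (by `Iff.rfl`). -/
theorem typeData_iff (θ : ℝ) :
    TypeData θ ↔
      ∀ (t L : ℕ), 1 ≤ t → ∃ D₀ L₁ : ℕ, L ≤ L₁ ∧ ∀ D : ℕ, D₀ ≤ D → ∀ C η : ℝ, 0 < C → 0 < η →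
        ∃ ε : ℝ, 0 < ε ∧ ∃ N₀ : ℕ, TypeDataAt θ t L L₁ D C η ε N₀ :=
  Iff.rfl

/-- L♭ is WEAKER than the `L`-atom at any fixed positive level `θ₁`. -/
theorem lowClassSecondMomentFlat_of_fixed {θ₁ : ℝ} (hθ₁ : 0 < θ₁) (h : LowClassSecondMoment θ₁) :
    LowClassSecondMomentFlat :=
  fun ε hε => ⟨θ₁, hθ₁, h ε hε⟩

/-- L♭ is monotone in the accuracy parameter of its `…At` form: a bound at accuracy `ε` is a bound at every
`ε' ≥ ε`. -/
theorem lowClassSecondMomentAt_mono {θ₁ ε ε' : ℝ} (hε : ε ≤ ε') {N₀ : ℕ}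
    (h : LowClassSecondMomentAt θ₁ ε N₀) : LowClassSecondMomentAt θ₁ ε' N₀ := by
  intro N hN q hq hqN
  refine (h N hN q hq hqN).trans ?_
  have hφ : (0 : ℝ) ≤ (N : ℝ) ^ 2 / Nat.totient q := by positivity
  have hlog : (0 : ℝ) ≤ (N : ℝ) * Real.log N :=
    mul_nonneg (Nat.cast_nonneg N) (Real.log_natCast_nonneg N)
  nlinarith

/-- L♭'s `…At` form is monotone in the level: a bound to level `N^{θ₁}` is a bound to every smaller level
`N^{θ₁'}`, `θ₁' ≤ θ₁` (for `N ≥ 1`; at `N = 0` the range `q ≤ 0^θ` only shrinks as well since `0 < θ₁' ≤ θ₁`). -/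
theorem lowClassSecondMomentAt_level_mono {θ₁ θ₁' ε : ℝ} (hθ' : 0 < θ₁') (hθ : θ₁' ≤ θ₁) {N₀ : ℕ}
    (h : LowClassSecondMomentAt θ₁ ε N₀) : LowClassSecondMomentAt θ₁' ε N₀ := by
  intro N hN q hq hqN
  refine h N hN q hq (hqN.trans ?_)
  rcases Nat.eq_zero_or_pos N with rfl | hNpos
  · have h1 : (0 : ℝ) < θ₁ := hθ'.trans_le hθ
    simp [Real.zero_rpow h1.ne', Real.zero_rpow hθ'.ne']
  · exact Real.rpow_le_rpow_of_exponent_le (by exact_mod_cast hNpos) hθ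

/-- TCM♭ is WEAKER than the type-class moments at any fixed positive level `θ₁`. -/
theorem typeClassMomentsFlat_of_fixed {θ₁ : ℝ} (hθ₁ : 0 < θ₁) (h : TypeClassMoments θ₁) :
    TypeClassMomentsFlat :=
  fun t L ht δ ε hδ hε => ⟨θ₁, hθ₁, h t L ht δ ε hδ hε⟩

/-- TypeData♭ is WEAKER than the landed `TypeData θ` (quantifier re-ordering only). -/
theorem typeDataFlat_of_typeData {θ : ℝ} (h : TypeData θ) : TypeDataFlat θ := by
  intro t L ht
  obtain ⟨D₀, L₁, hL, hD⟩ := h t L ht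
  exact ⟨L₁, hL, fun C η hC hη => ⟨D₀, fun D hDD => hD D hDD C η hC hη⟩⟩

/-- Hence Endgame♭ is STRONGER than the landed `Endgame θ` (it consumes the weaker data). -/
theorem endgame_of_endgameFlat {θ : ℝ} (h : EndgameFlat θ) : Endgame θ :=
  fun hP hData hRig hW => h hP (typeDataFlat_of_typeData hData) hRig hW

end Summit.Parity.GeneralizedHardyLittlewood.Cruxes.RelativeDimOne.FloatingLevelCore

end
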